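import Summits.ResolutionOfSingularities.ResolutionOfSingularities.Theorems.EquisingularLiftEquisingularLiftNatHorizontalForced
import Summits.ResolutionOfSingularities.ResolutionOfSingularities.Theorems.EquisingularLiftEquisingularLiftNatUltOfNat
import Summits.ResolutionOfSingularities.ResolutionOfSingularities.Theorems.EquisingularLiftEquisingularLiftNatHorizChain
import Summits.ResolutionOfSingularities.ResolutionOfSingularities.Theorems.EquisingularLiftCampaignW45bELNatAt
import HarnessLib

/-!
# [OURS · L1 W4.5(b) · EL♮] HORIZONTALITY IS FORCED in the item's ambient `ℙⁿ_O`: `ELNatOver ↔ horizontal form`,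
# `ELNatAt ↔ …`, and `EquisingularLiftNat p ↔ its horizontal form` — any `n`
# (crux `EquisingularLiftNat` = stmt-ResolutionOfSingularities-20038; object T-HORIZ-FORCED, part 2 of 2)

HONEST FRAMING. OURS (cell res-hironaka, crux chain w45b, slot W4.5(b)); NOT a statement of any manuscript; replaces the role
of NOTHING in the manuscript; AI-written, AI review is weaker than expert review. Helper `--supports
stmt-ResolutionOfSingularities-20038 --as helper` (any-`n` object). Part 1 (`…NatHorizontalForced.lean`) proves, over a
general base, that a typed E1 chain with irreducible LAST special fibre lies in the HORIZONTAL E1 closure. Here the base facts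
of `ℙⁿ_O` (as in `ult_of_equisingularLiftNat`, p505870: `ℙⁿ_O` integral Noetherian; generic point off the special fibre
because `q` is smooth hence open and the DVR `O` is not a field; special fibre irreducible,
`isIntegral_specialFibre_projectiveSpace`; `Y ≠` the special fibre because a NON-regular `H` is not all of the regular `ℙⁿ_k`)
discharge its hypotheses, and p500485 gives the converse:

* `horizontal_of_elNatOver` — EL♮ for `H` over `(O, π)` (`ELNatOver`, res-L1-type-o1 p503491) with `H` NOT regular ⇒ its
  HORIZONTAL form over the SAME `(O, π)` (verbatim the shape of the registered `stub_elnat_three_horiz` / p500485);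
* `elNatOver_of_horizontal` — the converse per `H`, any `n` (p500485 `natChain_and_isIrreducible_of_horizChainE1` with the
  base facts of `stub_elnat_three_of_horiz`);
* `elNatOver_iff_horizontal`, `elNatAt_iff_horizontal` — the registered horizontal stubs of the line `sections`
  (`stub_elnat_three_isolated_nonabs`, `stub_elnat_three_nonisolated`, …) are EQUIVALENT to the item's slices, not merely
  sufficient; every refuter of stmt-20038 / stmt-20148 may assume all centres `O`-flat;
* `equisingularLiftNat_iff_horizontal` — THE ITEM ⟺ ITS HORIZONTAL FORM, any `n` (regular `H`: `elnat_of_isRegular`,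
  p498240) = the converse of `stub_elnat_three_of_horiz` for every `n`.

References: tree files `…NatHorizontalForced` (part 1), `…NatUltOfNat` (p505870), `…NatHorizChain` (p500485),
`…NatRegularCase` (p498240), `…CampaignW45bELNatAt` (p503491), `…ProjectiveAmbient*`, `Literature…ProjectiveSpaceRegular`;
GW I Prop. 13.91 [GortzWedhorn2020]; Liu 2002 Thm 8.1.19 [Liu2002].
-/

set_option linter.dupNamespace false -- mandated namespace `Summit.<Summit>.<Problem>` of this single-conjunct summit
set_option linter.overlappingInstances false -- item signatures carry `[IsDomain O] [IsDiscreteValuationRing O]`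

noncomputable section

open CategoryTheory AlgebraicGeometry TopologicalSpace Topology
open Literature.AlgebraicGeometry.Resolution
open AlgebraicGeometry.Scheme.IdealSheafData
open Summit.ResolutionOfSingularities.ResolutionOfSingularities.Theses.EquisingularLift.Split
open Summit.ResolutionOfSingularities.ResolutionOfSingularities.Cruxes.EquisingularLift.StrataSplit
open Summit.ResolutionOfSingularities.ResolutionOfSingularities.Theorems.EquisingularLift

namespace Summit.ResolutionOfSingularities.ResolutionOfSingularities.Cruxes.EquisingularLiftNat.Sections

/-! ## The item's ambient `ℙⁿ_O`: EL♮ at `H` over `(O, π)` ⟺ its horizontal form (any `n`, `H` not regular) -/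

/-- **HORIZONTALITY IS FORCED for EL♮ (any `n`).** Let `H ↪ ℙⁿ_k` be an integral closed subscheme which is NOT regular, `O` a
characteristic-0 DVR with a surjection `π : O → k`. If EL♮ holds for `H` over `(O, π)` (`ELNatOver`: for every graded `φ`
inducing `MvPolynomial.map π` and `Y = range (ι ≫ Proj.map φ)` an E1 chain of the item with irreducible last special fibre and
regular reduced closure), then its HORIZONTAL form holds over the same `(O, π)`: the chain may be taken with every centre
`O`-FLAT (verbatim the hypothesis shape of `stub_elnat_three_horiz` / p500485). Base facts for `ℙⁿ_O` as in
`ult_of_equisingularLiftNat` (p505870): `ℙⁿ_O` integral Noetherian, generic point off the special fibre (`q` smooth ⇒ open),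
special fibre irreducible (`isIntegral_specialFibre_projectiveSpace`), and `Y ≠` the special fibre because a non-regular `H` is
not all of the regular `ℙⁿ_k`. Replaces the role of NOTHING in the manuscript; NOT a statement of the manuscript. [folklore] -/
theorem horizontal_of_elNatOver {p : ℕ} {k : Type} [Field k] [CharP k p] [IsAlgClosed k] {n : ℕ}
    {H : AlgebraicGeometry.Scheme.{0}} {ι : H ⟶ (Literature.AlgebraicGeometry.Motives.projectiveSpace n k).left}
    (hι : AlgebraicGeometry.IsClosedImmersion ι) (hH : AlgebraicGeometry.IsIntegral H)
    (hHreg : ¬ Literature.AlgebraicGeometry.Resolution.Scheme.IsRegular H)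
    {O : Type} [CommRing O] [IsDomain O] [IsDiscreteValuationRing O] [CharZero O] {π : O →+* k}
    (hπ : Function.Surjective π) (h : ELNatOver p k n H ι O π) :
    (letI := MvPolynomial.gradedAlgebra (σ := Fin (n + 1)) (R := O); letI := MvPolynomial.gradedAlgebra (σ := Fin (n + 1)) (R := k); ∀ (φ : MvPolynomial.homogeneousSubmodule (Fin (n + 1)) O →+*ᵍ MvPolynomial.homogeneousSubmodule (Fin (n + 1)) k) (hφ' : HomogeneousIdeal.irrelevant (MvPolynomial.homogeneousSubmodule (Fin (n + 1)) k) ≤ (HomogeneousIdeal.irrelevant (MvPolynomial.homogeneousSubmodule (Fin (n + 1)) O)).map φ), (∀ s, φ s = MvPolynomial.map π s) → ∀ Y : Set (AlgebraicGeometry.Proj (MvPolynomial.homogeneousSubmodule (Fin (n + 1)) O)), Y = Set.range (CategoryTheory.CategoryStruct.comp ι (AlgebraicGeometry.Proj.map φ hφ') : H ⟶ (AlgebraicGeometry.Proj (MvPolynomial.homogeneousSubmodule (Fin (n + 1)) O))) → ∃ (P' : AlgebraicGeometry.Scheme.{0}) (σ : P' ⟶ (AlgebraicGeometry.Proj (MvPolynomial.homogeneousSubmodule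 (Fin (n + 1)) O))) (S' : Set P'), (∀ Q : (∀ X' : AlgebraicGeometry.Scheme.{0}, (X' ⟶ (AlgebraicGeometry.Proj (MvPolynomial.homogeneousSubmodule (Fin (n + 1)) O))) → Set X' → Prop), Q (AlgebraicGeometry.Proj (MvPolynomial.homogeneousSubmodule (Fin (n + 1)) O)) (CategoryTheory.CategoryStruct.id _) Y → (∀ (X' X'' : AlgebraicGeometry.Scheme.{0}) (σ' : X' ⟶ (AlgebraicGeometry.Proj (MvPolynomial.homogeneousSubmodule (Fin (n + 1)) O))) (Y' : Set X') (C : X'.IdealSheafData) (τ : X'' ⟶ X'), Q X' σ' Y' → Literature.AlgebraicGeometry.Resolution.IsBlowup τ C → Literature.AlgebraicGeometry.Resolution.Scheme.IsRegular C.subscheme → AlgebraicGeometry.Flat (CategoryTheory.CategoryStruct.comp C.subschemeι (CategoryTheory.CategoryStruct.comp σ' (CategoryTheory.CategoryStruct.comp (AlgebraicGeometry.Proj.toSpecZero (MvPolynomial.homogeneousSubmodule (Fin (n + 1)) O)) (AlgebraicGeometry.Spec.map (CommRingCat.ofHom (algebraMap O (MvPolynomial.homogeneousSubmodule (Fin (n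 + 1)) O 0))))))) → σ' '' (C.support : Set X') ⊆ {x | ¬ IsGenericPoint x Y} → (C.support : Set X') ∩ (CategoryTheory.CategoryStruct.comp σ' (CategoryTheory.CategoryStruct.comp (AlgebraicGeometry.Proj.toSpecZero (MvPolynomial.homogeneousSubmodule (Fin (n + 1)) O)) (AlgebraicGeometry.Spec.map (CommRingCat.ofHom (algebraMap O (MvPolynomial.homogeneousSubmodule (Fin (n + 1)) O 0)))))) ⁻¹' {IsLocalRing.closedPoint O} ⊆ Y' → Q X'' (CategoryTheory.CategoryStruct.comp τ σ') (closure (τ ⁻¹' (Y' \ (C.support : Set X'))))) → Q P' σ S') ∧ Literature.AlgebraicGeometry.Resolution.Scheme.IsRegular (AlgebraicGeometry.Scheme.IdealSheafData.vanishingIdeal (⟨closure S', isClosed_closure⟩ : TopologicalSpace.Closeds P')).subscheme) := by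
  letI := MvPolynomial.gradedAlgebra (σ := Fin (n + 1)) (R := O)
  letI := MvPolynomial.gradedAlgebra (σ := Fin (n + 1)) (R := k)
  intro φ hφ' hφ Y hY
  haveI := hH
  obtain ⟨P', σ, S', hchain, hirr, hregS⟩ := h φ hφ' hφ Y hY
  -- the base `q : ℙⁿ_O → Spec O`
  set q : Proj (MvPolynomial.homogeneousSubmodule (Fin (n + 1)) O) ⟶ Spec (.of O) :=
    Proj.toSpecZero (MvPolynomial.homogeneousSubmodule (Fin (n + 1)) O) ≫
      Spec.map (CommRingCat.ofHom (algebraMap O (MvPolynomial.homogeneousSubmodule (Fin (n + 1)) O 0))) with hq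
  obtain ⟨hsm, hprop⟩ := stub_projectiveAmbientSmoothProper O n
  haveI : IsProper q := hprop
  haveI : Smooth q := hsm
  haveI : IsNoetherianRing (CommRingCat.of O) := inferInstanceAs (IsNoetherianRing O)
  haveI : IsDomain (CommRingCat.of O) := inferInstanceAs (IsDomain O)
  haveI : IsLocallyNoetherian (Proj (MvPolynomial.homogeneousSubmodule (Fin (n + 1)) O)) :=
    LocallyOfFiniteType.isLocallyNoetherian q
  haveI : CompactSpace ↥(Proj (MvPolynomial.homogeneousSubmodule (Fin (n + 1)) O)) :=
    QuasiCompact.compactSpace_of_compactSpace q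
  haveI : IsIntegral (Proj (MvPolynomial.homogeneousSubmodule (Fin (n + 1)) O)) :=
    Proj.isIntegral _ (irrelevant_homogeneousSubmodule_ne_bot n O)
  -- the comparison `g : ℙⁿ_k → ℙⁿ_O`, a closed immersion onto the special fibre
  set g : Proj (MvPolynomial.homogeneousSubmodule (Fin (n + 1)) k) ⟶
      Proj (MvPolynomial.homogeneousSubmodule (Fin (n + 1)) O) := Proj.map φ hφ' with hg
  have hP := ProjectiveAmbientFibre.isPullback_projMap π φ hφ hπ hφ'
  haveI : IsClosedImmersion (Spec.map (CommRingCat.ofHom π)) := IsClosedImmersion.spec_of_surjective _ hπ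
  haveI hgci : IsClosedImmersion g := MorphismProperty.IsStableUnderBaseChange.of_isPullback hP.flip inferInstance
  have hpt : ∀ z : Spec (.of k), Spec.map (CommRingCat.ofHom π) z = IsLocalRing.closedPoint O := by
    intro z
    rw [Spec.map_apply]
    apply PrimeSpectrum.ext
    rw [PrimeSpectrum.comap_asIdeal, CommRingCat.hom_ofHom, Ideal.eq_bot_of_prime z.asIdeal, ← RingHom.ker_eq_comap_bot]
    exact IsLocalRing.eq_maximalIdeal (RingHom.ker_isMaximal_of_surjective π hπ)
  have hgq : ∀ z, q (g z) = IsLocalRing.closedPoint O := fun z ↦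
    (Scheme.Hom.comp_apply g q z).symm.trans
      ((congrArg (fun h : Proj (MvPolynomial.homogeneousSubmodule (Fin (n + 1)) k) ⟶ Spec (.of O) ↦ h z) hP.w).trans
        ((Scheme.Hom.comp_apply _ _ z).trans (hpt _)))
  -- `ι` as a closed immersion into `Proj k[x]`
  let ι' : H ⟶ Proj (MvPolynomial.homogeneousSubmodule (Fin (n + 1)) k) := ι
  haveI : IsClosedImmersion ι' := hι
  have hYF : Y ⊆ q ⁻¹' {IsLocalRing.closedPoint O} := by
    rw [hY]
    rintro _ ⟨a, rfl⟩
    show q ((ι ≫ g) a) = IsLocalRing.closedPoint O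
    rw [Scheme.Hom.comp_apply]
    exact hgq (ι a)
  have hYcl : IsClosed Y := by rw [hY]; exact (ι' ≫ g).isClosedEmbedding.isClosed_range
  -- a point of `ℙⁿ_k` outside `range ι` (else `H ≅ ℙⁿ_k` would be regular)
  have hH' : ∃ z : Proj (MvPolynomial.homogeneousSubmodule (Fin (n + 1)) k), z ∉ Set.range ι' := by
    by_contra hall
    push Not at hall
    have hrange : Set.range (𝟙 (Proj (MvPolynomial.homogeneousSubmodule (Fin (n + 1)) k))) = Set.range ι' := by
      ext z; simpa using hall z
    haveI : IsIntegral (Proj (MvPolynomial.homogeneousSubmodule (Fin (n + 1)) k)) :=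
      isIntegral_proj_homogeneousSubmodule n k
    apply hHreg
    intro x
    have hregP : IsRegularLocalRing ((Proj (MvPolynomial.homogeneousSubmodule (Fin (n + 1)) k)).presheaf.stalk (ι' x)) :=
      isRegular_projectiveSpace n k (ι' x)
    exact (isRegularLocalRing_stalk_iff_of_range_eq (𝟙 _) ι' hrange (a₁ := ι' x) (a₂ := x) (by simp)).mpr hregP
  -- no maximal point of the (irreducible) special fibre lies in `closure Y = Y`
  have hirrP : IsIrreducible (q ⁻¹' {IsLocalRing.closedPoint O}) := by
    haveI := isIntegral_specialFibre_projectiveSpace O n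
    exact isIrreducible_preimage_closedPoint O _ q
  have hNM : ∀ w, (w ∈ q ⁻¹' {IsLocalRing.closedPoint O} ∧
      ∀ y ∈ q ⁻¹' {IsLocalRing.closedPoint O}, y ⤳ w → y = w) → w ∉ closure Y := by
    intro w hw hwY
    obtain ⟨ζ, hζ⟩ := QuasiSober.sober hirrP
      ((IsLocalRing.isClosed_singleton_closedPoint O).preimage q.base.hom.continuous)
    have hζw : ζ = w := hw.2 ζ hζ.mem (hζ.specializes hw.1)
    rw [hYcl.closure_eq] at hwY
    have hFY : q ⁻¹' {IsLocalRing.closedPoint O} ⊆ Y := by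
      rw [← hζ.def, hζw]
      exact closure_minimal (Set.singleton_subset_iff.mpr hwY) hYcl
    obtain ⟨z, hz⟩ := hH'
    have hgz : g z ∈ Y := hFY (hgq z)
    rw [hY] at hgz
    obtain ⟨a, ha⟩ := hgz
    rw [Scheme.Hom.comp_apply] at ha
    exact hz ⟨a, g.isClosedEmbedding.injective ha⟩
  -- the generic point of `ℙⁿ_O` is off the special fibre (`q` smooth ⇒ open; the DVR `O` is not a field)
  have hgenP : ∀ ξ : Proj (MvPolynomial.homogeneousSubmodule (Fin (n + 1)) O),
      IsGenericPoint ξ (Set.univ : Set (Proj (MvPolynomial.homogeneousSubmodule (Fin (n + 1)) O))) →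
        ξ ∉ q ⁻¹' {IsLocalRing.closedPoint O} := by
    intro ξ hξ hξF
    have hopen : IsOpen (Set.range q) := by
      rw [← Set.image_univ]; exact q.isOpenMap _ isOpen_univ
    have hne : (Set.range q).Nonempty := ⟨q ξ, ξ, rfl⟩
    have hgen : genericPoint (Spec (.of O)) ∈ Set.range q := by
      rw [(genericPoint_spec (Spec (.of O))).mem_open_set_iff hopen]
      simpa using hne
    obtain ⟨p₀, hp₀⟩ := hgen
    have hp₀F : p₀ ∈ q ⁻¹' {IsLocalRing.closedPoint O} := by
      have hF : q ⁻¹' {IsLocalRing.closedPoint O} = Set.univ := by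
        apply Set.eq_univ_of_univ_subset
        rw [← hξ.def]
        exact closure_minimal (Set.singleton_subset_iff.mpr hξF)
          ((IsLocalRing.isClosed_singleton_closedPoint O).preimage q.base.hom.continuous)
      rw [hF]; trivial
    have h1 : genericPoint (Spec (.of O)) = IsLocalRing.closedPoint O := hp₀.symm.trans hp₀F
    rw [genericPoint_eq_bot_of_affine] at h1
    have h2 := congrArg PrimeSpectrum.asIdeal h1
    exact IsDiscreteValuationRing.not_a_field O h2.symm
  exact ⟨P', σ, S', horizChain_of_natChain_of_isIrreducible q Y σ S' hchain hirr hgenP hYF hNM, hregS⟩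

/-- **The converse, per `H` and any `n` (p500485 repackaged): a HORIZONTAL E1 chain over `(O, π)` with regular reduced
closure gives EL♮ for `H` over `(O, π)`** — irreducibility of the last special fibre is automatic
(`natChain_and_isIrreducible_of_horizChainE1`); base facts `isPullback_projMap`, `stub_projectiveAmbientSmoothProper`,
`isIntegral_specialFibre_projectiveSpace` exactly as in `stub_elnat_three_of_horiz`. [folklore] -/
theorem elNatOver_of_horizontal {p : ℕ} {k : Type} [Field k] [CharP k p] [IsAlgClosed k] {n : ℕ}
    {H : AlgebraicGeometry.Scheme.{0}} {ι : H ⟶ (Literature.AlgebraicGeometry.Motives.projectiveSpace n k).left}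
    (hι : AlgebraicGeometry.IsClosedImmersion ι) (hH : AlgebraicGeometry.IsIntegral H)
    {O : Type} [CommRing O] [IsDomain O] [IsDiscreteValuationRing O] [CharZero O] {π : O →+* k}
    (hπ : Function.Surjective π)
    (h : (letI := MvPolynomial.gradedAlgebra (σ := Fin (n + 1)) (R := O); letI := MvPolynomial.gradedAlgebra (σ := Fin (n + 1)) (R := k); ∀ (φ : MvPolynomial.homogeneousSubmodule (Fin (n + 1)) O →+*ᵍ MvPolynomial.homogeneousSubmodule (Fin (n + 1)) k) (hφ' : HomogeneousIdeal.irrelevant (MvPolynomial.homogeneousSubmodule (Fin (n + 1)) k) ≤ (HomogeneousIdeal.irrelevant (MvPolynomial.homogeneousSubmodule (Fin (n + 1)) O)).map φ), (∀ s, φ s = MvPolynomial.map π s) → ∀ Y : Set (AlgebraicGeometry.Proj (MvPolynomial.homogeneousSubmodule (Fin (n + 1)) O)), Y = Set.range (CategoryTheory.CategoryStruct.comp ι (AlgebraicGeometry.Proj.map φ hφ') : H ⟶ (AlgebraicGeometry.Proj (MvPolynomial.homogeneousSubmodule (Fin (n + 1)) O))) → ∃ (P' : AlgebraicGeometry.Scheme.{0})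 (σ : P' ⟶ (AlgebraicGeometry.Proj (MvPolynomial.homogeneousSubmodule (Fin (n + 1)) O))) (S' : Set P'), (∀ Q : (∀ X' : AlgebraicGeometry.Scheme.{0}, (X' ⟶ (AlgebraicGeometry.Proj (MvPolynomial.homogeneousSubmodule (Fin (n + 1)) O))) → Set X' → Prop), Q (AlgebraicGeometry.Proj (MvPolynomial.homogeneousSubmodule (Fin (n + 1)) O)) (CategoryTheory.CategoryStruct.id _) Y → (∀ (X' X'' : AlgebraicGeometry.Scheme.{0}) (σ' : X' ⟶ (AlgebraicGeometry.Proj (MvPolynomial.homogeneousSubmodule (Fin (n + 1)) O))) (Y' : Set X') (C : X'.IdealSheafData) (τ : X'' ⟶ X'), Q X' σ' Y' → Literature.AlgebraicGeometry.Resolution.IsBlowup τ C → Literature.AlgebraicGeometry.Resolution.Scheme.IsRegular C.subscheme → AlgebraicGeometry.Flat (CategoryTheory.CategoryStruct.comp C.subschemeι (CategoryTheory.CategoryStruct.comp σ' (CategoryTheory.CategoryStruct.comp (AlgebraicGeometry.Proj.toSpecZero (MvPolynomial.homogeneousSubmodule (Fin (n + 1)) O)) (AlgebraicGeometry.Spec.map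 (CommRingCat.ofHom (algebraMap O (MvPolynomial.homogeneousSubmodule (Fin (n + 1)) O 0))))))) → σ' '' (C.support : Set X') ⊆ {x | ¬ IsGenericPoint x Y} → (C.support : Set X') ∩ (CategoryTheory.CategoryStruct.comp σ' (CategoryTheory.CategoryStruct.comp (AlgebraicGeometry.Proj.toSpecZero (MvPolynomial.homogeneousSubmodule (Fin (n + 1)) O)) (AlgebraicGeometry.Spec.map (CommRingCat.ofHom (algebraMap O (MvPolynomial.homogeneousSubmodule (Fin (n + 1)) O 0)))))) ⁻¹' {IsLocalRing.closedPoint O} ⊆ Y' → Q X'' (CategoryTheory.CategoryStruct.comp τ σ') (closure (τ ⁻¹' (Y' \ (C.support : Set X'))))) → Q P' σ S') ∧ Literature.AlgebraicGeometry.Resolution.Scheme.IsRegular (AlgebraicGeometry.Scheme.IdealSheafData.vanishingIdeal (⟨closure S', isClosed_closure⟩ : TopologicalSpace.Closeds P')).subscheme)) :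
    ELNatOver p k n H ι O π := by
  classical
  letI := MvPolynomial.gradedAlgebra (σ := Fin (n + 1)) (R := O)
  letI := MvPolynomial.gradedAlgebra (σ := Fin (n + 1)) (R := k)
  intro φ hφ' hφ Y hY
  obtain ⟨P', σ, S', hhz, hreg'⟩ := h φ hφ' hφ Y hY
  subst hY
  have hP := ProjectiveAmbientFibre.isPullback_projMap π φ hφ hπ hφ'
  set q : (AlgebraicGeometry.Proj (MvPolynomial.homogeneousSubmodule (Fin (n + 1)) O)) ⟶ Spec (.of O) :=
    Proj.toSpecZero (MvPolynomial.homogeneousSubmodule (Fin (n + 1)) O) ≫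
      Spec.map (CommRingCat.ofHom (algebraMap O (MvPolynomial.homogeneousSubmodule (Fin (n + 1)) O 0))) with hq
  set g : (AlgebraicGeometry.Proj (MvPolynomial.homogeneousSubmodule (Fin (n + 1)) k)) ⟶ (AlgebraicGeometry.Proj (MvPolynomial.homogeneousSubmodule (Fin (n + 1)) O)) :=
    Proj.map φ hφ' with hg
  haveI : IsClosedImmersion (Spec.map (CommRingCat.ofHom π)) := IsClosedImmersion.spec_of_surjective _ hπ
  haveI : IsClosedImmersion g := MorphismProperty.IsStableUnderBaseChange.of_isPullback hP.flip inferInstance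
  have hpt : ∀ x : Spec (.of k), Spec.map (CommRingCat.ofHom π) x = IsLocalRing.closedPoint O := by
    intro x
    rw [Spec.map_apply]
    apply PrimeSpectrum.ext
    rw [PrimeSpectrum.comap_asIdeal, CommRingCat.hom_ofHom, Ideal.eq_bot_of_prime x.asIdeal, ← RingHom.ker_eq_comap_bot]
    exact IsLocalRing.eq_maximalIdeal (RingHom.ker_isMaximal_of_surjective π hπ)
  have hgq : ∀ x, q (g x) = IsLocalRing.closedPoint O := fun x ↦
    (Scheme.Hom.comp_apply g q x).symm.trans
      ((congrArg (fun h : (AlgebraicGeometry.Proj (MvPolynomial.homogeneousSubmodule (Fin (n + 1)) k)) ⟶ Spec (.of O) ↦ h x) hP.w).trans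
        ((Scheme.Hom.comp_apply _ _ x).trans (hpt _)))
  haveI := hH
  let ι' : H ⟶ (AlgebraicGeometry.Proj (MvPolynomial.homogeneousSubmodule (Fin (n + 1)) k)) := ι
  haveI : IsClosedImmersion ι' := hι
  let f : H ⟶ (AlgebraicGeometry.Proj (MvPolynomial.homogeneousSubmodule (Fin (n + 1)) O)) := ι' ≫ g
  have hf : Set.range (CategoryStruct.comp ι g : H ⟶ (AlgebraicGeometry.Proj (MvPolynomial.homogeneousSubmodule (Fin (n + 1)) O))) = Set.range f := rfl
  have hYcl : IsClosed (Set.range f) := f.isClosedEmbedding.isClosed_range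
  have hsub : Set.range f ⊆ q ⁻¹' {IsLocalRing.closedPoint O} := by
    rintro _ ⟨x, rfl⟩
    show q (f x) = IsLocalRing.closedPoint O
    rw [show f x = g (ι' x) from Scheme.Hom.comp_apply _ _ x]
    exact hgq (ι' x)
  have hgen : IsGenericPoint (f (genericPoint H)) (Set.range f) := by
    have h := (genericPoint_spec H).image f.continuous
    rwa [Set.image_univ, f.isClosedEmbedding.isClosed_range.closure_eq] at h
  have hYirr : IsIrreducible (Set.range f) := by
    have h := (isIrreducible_singleton (x := f (genericPoint H))).closure
    rwa [hgen] at h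
  obtain ⟨hsm, hprop⟩ := stub_projectiveAmbientSmoothProper O n
  have hint := isIntegral_specialFibre_projectiveSpace O n
  rw [hf] at hhz ⊢
  obtain ⟨hch, hirr⟩ :=
    natChain_and_isIrreducible_of_horizChainE1 O _ P' q (Set.range f) σ S' hsm hprop hint hYirr hYcl hsub hhz
  exact ⟨P', σ, S', hch, hirr, hreg'⟩

/-- **EL♮ at `H` over `(O, π)` ⟺ its horizontal form** (`H` integral, not regular; any `n`). [folklore] -/
theorem elNatOver_iff_horizontal {p : ℕ} {k : Type} [Field k] [CharP k p] [IsAlgClosed k] {n : ℕ}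
    {H : AlgebraicGeometry.Scheme.{0}} {ι : H ⟶ (Literature.AlgebraicGeometry.Motives.projectiveSpace n k).left}
    (hι : AlgebraicGeometry.IsClosedImmersion ι) (hH : AlgebraicGeometry.IsIntegral H)
    (hHreg : ¬ Literature.AlgebraicGeometry.Resolution.Scheme.IsRegular H)
    {O : Type} [CommRing O] [IsDomain O] [IsDiscreteValuationRing O] [CharZero O] {π : O →+* k}
    (hπ : Function.Surjective π) :
    ELNatOver p k n H ι O π ↔ (letI := MvPolynomial.gradedAlgebra (σ := Fin (n + 1)) (R := O); letI := MvPolynomial.gradedAlgebra (σ := Fin (n + 1)) (R := k); ∀ (φ : MvPolynomial.homogeneousSubmodule (Fin (n + 1)) O →+*ᵍ MvPolynomial.homogeneousSubmodule (Fin (n + 1)) k) (hφ' : HomogeneousIdeal.irrelevant (MvPolynomial.homogeneousSubmodule (Fin (n + 1)) k) ≤ (HomogeneousIdeal.irrelevant (MvPolynomial.homogeneousSubmodule (Fin (n + 1)) O)).map φ), (∀ s, φ s = MvPolynomial.map π s) → ∀ Y : Set (AlgebraicGeometry.Proj (MvPolynomial.homogeneousSubmodule (Fin (n + 1)) O)),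 Y = Set.range (CategoryTheory.CategoryStruct.comp ι (AlgebraicGeometry.Proj.map φ hφ') : H ⟶ (AlgebraicGeometry.Proj (MvPolynomial.homogeneousSubmodule (Fin (n + 1)) O))) → ∃ (P' : AlgebraicGeometry.Scheme.{0}) (σ : P' ⟶ (AlgebraicGeometry.Proj (MvPolynomial.homogeneousSubmodule (Fin (n + 1)) O))) (S' : Set P'), (∀ Q : (∀ X' : AlgebraicGeometry.Scheme.{0}, (X' ⟶ (AlgebraicGeometry.Proj (MvPolynomial.homogeneousSubmodule (Fin (n + 1)) O))) → Set X' → Prop), Q (AlgebraicGeometry.Proj (MvPolynomial.homogeneousSubmodule (Fin (n + 1)) O)) (CategoryTheory.CategoryStruct.id _) Y → (∀ (X' X'' : AlgebraicGeometry.Scheme.{0}) (σ' : X' ⟶ (AlgebraicGeometry.Proj (MvPolynomial.homogeneousSubmodule (Fin (n + 1)) O))) (Y' : Set X') (C : X'.IdealSheafData) (τ : X'' ⟶ X'), Q X' σ' Y' → Literature.AlgebraicGeometry.Resolution.IsBlowup τ C → Literature.AlgebraicGeometry.Resolution.Scheme.IsRegular C.subscheme → AlgebraicGeometry.Flat (CategoryTheory.CategoryStruct.comp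 C.subschemeι (CategoryTheory.CategoryStruct.comp σ' (CategoryTheory.CategoryStruct.comp (AlgebraicGeometry.Proj.toSpecZero (MvPolynomial.homogeneousSubmodule (Fin (n + 1)) O)) (AlgebraicGeometry.Spec.map (CommRingCat.ofHom (algebraMap O (MvPolynomial.homogeneousSubmodule (Fin (n + 1)) O 0))))))) → σ' '' (C.support : Set X') ⊆ {x | ¬ IsGenericPoint x Y} → (C.support : Set X') ∩ (CategoryTheory.CategoryStruct.comp σ' (CategoryTheory.CategoryStruct.comp (AlgebraicGeometry.Proj.toSpecZero (MvPolynomial.homogeneousSubmodule (Fin (n + 1)) O)) (AlgebraicGeometry.Spec.map (CommRingCat.ofHom (algebraMap O (MvPolynomial.homogeneousSubmodule (Fin (n + 1)) O 0)))))) ⁻¹' {IsLocalRing.closedPoint O} ⊆ Y' → Q X'' (CategoryTheory.CategoryStruct.comp τ σ') (closure (τ ⁻¹' (Y' \ (C.support : Set X'))))) → Q P' σ S') ∧ Literature.AlgebraicGeometry.Resolution.Scheme.IsRegular (AlgebraicGeometry.Scheme.IdealSheafData.vanishingIdeal (⟨closure S', isClosed_closure⟩ : TopologicalSpace.Closeds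 P')).subscheme) :=
  ⟨horizontal_of_elNatOver hι hH hHreg hπ, elNatOver_of_horizontal hι hH hπ⟩

/-- **EL♮ at `H` ⟺ its horizontal form** (`ELNatAt`; `H` integral, not regular; any `n`): the registered horizontal
stubs of the line `sections` are EQUIVALENT to the item's slices, not merely sufficient. [folklore] -/
theorem elNatAt_iff_horizontal {p : ℕ} {k : Type} [Field k] [CharP k p] [IsAlgClosed k] {n : ℕ}
    {H : AlgebraicGeometry.Scheme.{0}} {ι : H ⟶ (Literature.AlgebraicGeometry.Motives.projectiveSpace n k).left}
    (hι : AlgebraicGeometry.IsClosedImmersion ι) (hH : AlgebraicGeometry.IsIntegral H)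
    (hHreg : ¬ Literature.AlgebraicGeometry.Resolution.Scheme.IsRegular H) :
    ELNatAt p k n H ι ↔ ∃ (O : Type) (_ : CommRing O) (_ : IsDomain O) (_ : IsDiscreteValuationRing O) (_ : CharZero O) (π : O →+* k), Function.Surjective π ∧ (letI := MvPolynomial.gradedAlgebra (σ := Fin (n + 1)) (R := O); letI := MvPolynomial.gradedAlgebra (σ := Fin (n + 1)) (R := k); ∀ (φ : MvPolynomial.homogeneousSubmodule (Fin (n + 1)) O →+*ᵍ MvPolynomial.homogeneousSubmodule (Fin (n + 1)) k) (hφ' : HomogeneousIdeal.irrelevant (MvPolynomial.homogeneousSubmodule (Fin (n + 1)) k) ≤ (HomogeneousIdeal.irrelevant (MvPolynomial.homogeneousSubmodule (Fin (n + 1)) O)).map φ), (∀ s, φ s = MvPolynomial.map π s) → ∀ Y : Set (AlgebraicGeometry.Proj (MvPolynomial.homogeneousSubmodule (Fin (n + 1)) O)), Y = Set.range (CategoryTheory.CategoryStruct.comp ι (AlgebraicGeometry.Proj.map φ hφ') : H ⟶ (AlgebraicGeometry.Proj (MvPolynomial.homogeneousSubmodule (Fin (n + 1)) O))) → ∃ (P'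 : AlgebraicGeometry.Scheme.{0}) (σ : P' ⟶ (AlgebraicGeometry.Proj (MvPolynomial.homogeneousSubmodule (Fin (n + 1)) O))) (S' : Set P'), (∀ Q : (∀ X' : AlgebraicGeometry.Scheme.{0}, (X' ⟶ (AlgebraicGeometry.Proj (MvPolynomial.homogeneousSubmodule (Fin (n + 1)) O))) → Set X' → Prop), Q (AlgebraicGeometry.Proj (MvPolynomial.homogeneousSubmodule (Fin (n + 1)) O)) (CategoryTheory.CategoryStruct.id _) Y → (∀ (X' X'' : AlgebraicGeometry.Scheme.{0}) (σ' : X' ⟶ (AlgebraicGeometry.Proj (MvPolynomial.homogeneousSubmodule (Fin (n + 1)) O))) (Y' : Set X') (C : X'.IdealSheafData) (τ : X'' ⟶ X'), Q X' σ' Y' → Literature.AlgebraicGeometry.Resolution.IsBlowup τ C → Literature.AlgebraicGeometry.Resolution.Scheme.IsRegular C.subscheme → AlgebraicGeometry.Flat (CategoryTheory.CategoryStruct.comp C.subschemeι (CategoryTheory.CategoryStruct.comp σ' (CategoryTheory.CategoryStruct.comp (AlgebraicGeometry.Proj.toSpecZero (MvPolynomial.homogeneousSubmodule (Fin (n + 1))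 O)) (AlgebraicGeometry.Spec.map (CommRingCat.ofHom (algebraMap O (MvPolynomial.homogeneousSubmodule (Fin (n + 1)) O 0))))))) → σ' '' (C.support : Set X') ⊆ {x | ¬ IsGenericPoint x Y} → (C.support : Set X') ∩ (CategoryTheory.CategoryStruct.comp σ' (CategoryTheory.CategoryStruct.comp (AlgebraicGeometry.Proj.toSpecZero (MvPolynomial.homogeneousSubmodule (Fin (n + 1)) O)) (AlgebraicGeometry.Spec.map (CommRingCat.ofHom (algebraMap O (MvPolynomial.homogeneousSubmodule (Fin (n + 1)) O 0)))))) ⁻¹' {IsLocalRing.closedPoint O} ⊆ Y' → Q X'' (CategoryTheory.CategoryStruct.comp τ σ') (closure (τ ⁻¹' (Y' \ (C.support : Set X'))))) → Q P' σ S') ∧ Literature.AlgebraicGeometry.Resolution.Scheme.IsRegular (AlgebraicGeometry.Scheme.IdealSheafData.vanishingIdeal (⟨closure S', isClosed_closure⟩ : TopologicalSpace.Closeds P')).subscheme) := by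
  constructor
  · rintro ⟨O, i1, i2, i3, i4, π, hπ, h⟩
    exact ⟨O, i1, i2, i3, i4, π, hπ, horizontal_of_elNatOver hι hH hHreg hπ h⟩
  · rintro ⟨O, i1, i2, i3, i4, π, hπ, h⟩
    exact ⟨O, i1, i2, i3, i4, π, hπ, elNatOver_of_horizontal hι hH hπ h⟩

/-- **THE ITEM ⟺ ITS HORIZONTAL FORM (any `n`).** `EquisingularLiftNat p` holds iff for every integral NON-REGULAR
hypersurface `H ↪ ℙⁿ_k` there are a characteristic-0 DVR `O`, a surjection `π : O → k` and, for the fixed ambient `ℙⁿ_O`,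
a HORIZONTAL E1 chain (regular `O`-FLAT centres over non-generic points of `Y`, special support in the current strict
transform) with regular reduced last strict transform — i.e. the CONVERSE of `stub_elnat_three_of_horiz` holds for every `n`
(regular `H`: `elnat_of_isRegular`, p498240). Replaces the role of NOTHING in the manuscript; NOT a statement of the manuscript.
[folklore] -/
theorem equisingularLiftNat_iff_horizontal (p : ℕ) :
    Summit.ResolutionOfSingularities.ResolutionOfSingularities.Theorems.EquisingularLiftNat p ↔
      (p.Prime → ∀ (k : Type) [Field k] [CharP k p] [IsAlgClosed k] (n : ℕ) (H : AlgebraicGeometry.Scheme.{0}) (ι : H ⟶ (Literature.AlgebraicGeometry.Motives.projectiveSpace n k).left), AlgebraicGeometry.IsClosedImmersion ι → AlgebraicGeometry.IsIntegral H → (∀ y : (Literature.AlgebraicGeometry.Motives.projectiveSpace n k).left, ∃ U : (Literature.AlgebraicGeometry.Motives.projectiveSpace n k).left.affineOpens, y ∈ (U : (Literature.AlgebraicGeometry.Motives.projectiveSpace n k).left.Opens) ∧ (ι.ker.ideal U).IsPrincipal) → ¬ Literature.AlgebraicGeometry.Resolution.Scheme.IsRegular H → ∃ (O : Type) (_ :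 CommRing O) (_ : IsDomain O) (_ : IsDiscreteValuationRing O) (_ : CharZero O) (π : O →+* k), Function.Surjective π ∧ (letI := MvPolynomial.gradedAlgebra (σ := Fin (n + 1)) (R := O); letI := MvPolynomial.gradedAlgebra (σ := Fin (n + 1)) (R := k); ∀ (φ : MvPolynomial.homogeneousSubmodule (Fin (n + 1)) O →+*ᵍ MvPolynomial.homogeneousSubmodule (Fin (n + 1)) k) (hφ' : HomogeneousIdeal.irrelevant (MvPolynomial.homogeneousSubmodule (Fin (n + 1)) k) ≤ (HomogeneousIdeal.irrelevant (MvPolynomial.homogeneousSubmodule (Fin (n + 1)) O)).map φ), (∀ s, φ s = MvPolynomial.map π s) → ∀ Y : Set (AlgebraicGeometry.Proj (MvPolynomial.homogeneousSubmodule (Fin (n + 1)) O)), Y = Set.range (CategoryTheory.CategoryStruct.comp ι (AlgebraicGeometry.Proj.map φ hφ') : H ⟶ (AlgebraicGeometry.Proj (MvPolynomial.homogeneousSubmodule (Fin (n + 1)) O))) → ∃ (P' : AlgebraicGeometry.Scheme.{0}) (σ : P' ⟶ (AlgebraicGeometry.Proj (MvPolynomial.homogeneousSubmodule (Fin (n +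 1)) O))) (S' : Set P'), (∀ Q : (∀ X' : AlgebraicGeometry.Scheme.{0}, (X' ⟶ (AlgebraicGeometry.Proj (MvPolynomial.homogeneousSubmodule (Fin (n + 1)) O))) → Set X' → Prop), Q (AlgebraicGeometry.Proj (MvPolynomial.homogeneousSubmodule (Fin (n + 1)) O)) (CategoryTheory.CategoryStruct.id _) Y → (∀ (X' X'' : AlgebraicGeometry.Scheme.{0}) (σ' : X' ⟶ (AlgebraicGeometry.Proj (MvPolynomial.homogeneousSubmodule (Fin (n + 1)) O))) (Y' : Set X') (C : X'.IdealSheafData) (τ : X'' ⟶ X'), Q X' σ' Y' → Literature.AlgebraicGeometry.Resolution.IsBlowup τ C → Literature.AlgebraicGeometry.Resolution.Scheme.IsRegular C.subscheme → AlgebraicGeometry.Flat (CategoryTheory.CategoryStruct.comp C.subschemeι (CategoryTheory.CategoryStruct.comp σ' (CategoryTheory.CategoryStruct.comp (AlgebraicGeometry.Proj.toSpecZero (MvPolynomial.homogeneousSubmodule (Fin (n + 1)) O)) (AlgebraicGeometry.Spec.map (CommRingCat.ofHom (algebraMap O (MvPolynomial.homogeneousSubmodule (Fin (n + 1)) O 0)))))))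 → σ' '' (C.support : Set X') ⊆ {x | ¬ IsGenericPoint x Y} → (C.support : Set X') ∩ (CategoryTheory.CategoryStruct.comp σ' (CategoryTheory.CategoryStruct.comp (AlgebraicGeometry.Proj.toSpecZero (MvPolynomial.homogeneousSubmodule (Fin (n + 1)) O)) (AlgebraicGeometry.Spec.map (CommRingCat.ofHom (algebraMap O (MvPolynomial.homogeneousSubmodule (Fin (n + 1)) O 0)))))) ⁻¹' {IsLocalRing.closedPoint O} ⊆ Y' → Q X'' (CategoryTheory.CategoryStruct.comp τ σ') (closure (τ ⁻¹' (Y' \ (C.support : Set X'))))) → Q P' σ S') ∧ Literature.AlgebraicGeometry.Resolution.Scheme.IsRegular (AlgebraicGeometry.Scheme.IdealSheafData.vanishingIdeal (⟨closure S', isClosed_closure⟩ : TopologicalSpace.Closeds P')).subscheme)) := by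
  constructor
  · intro hE hp k _ _ _ n H ι hι hH hloc hHreg
    obtain ⟨O, i1, i2, i3, i4, π, hπ, h⟩ := hE hp k n H ι hι hH hloc
    exact ⟨O, i1, i2, i3, i4, π, hπ, horizontal_of_elNatOver hι hH hHreg hπ h⟩
  · intro h hp k _ _ _ n H ι hι hH hloc
    by_cases hHreg : Literature.AlgebraicGeometry.Resolution.Scheme.IsRegular H
    · exact elnat_of_isRegular p hp k n H ι hι hH hloc hHreg
    · obtain ⟨O, i1, i2, i3, i4, π, hπ, h'⟩ := h hp k n H ι hι hH hloc hHreg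
      exact ⟨O, i1, i2, i3, i4, π, hπ, elNatOver_of_horizontal hι hH hπ h'⟩

end Summit.ResolutionOfSingularities.ResolutionOfSingularities.Cruxes.EquisingularLiftNat.Sections

end
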